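import Summits.QuantumFields.GaugeBoot.DiagonalRPFiniteVolume
import Summits.QuantumFields.GaugeBoot.WilsonWeightNegativeBeta
import HarnessLib

/-!
# The one-plaquette witness against diagonal reflection positivity at `β < 0`: geometry and the pointwise identity (gauge-boot, L3(β) negative complement, part 1)

HONEST FRAMING (cell `pub-gaugeboot`, page 1 of every file): the venture produces certified bounds
on lattice expectations at stated coupling, gauge group, dimension and torus size; NOT a mass gap,
NOT a continuum limit, NOT a string tension; NOT Yang–Mills-summit-bearing (barriers
`FixedCouplingUltralocality`, `PerturbativeInvisibility`). Bookkeeping for the NEGATIVE structural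
result `DiagonalRPFiniteVolumeNegativeBeta.lean`: the diagonal reflection positivity of symmetric
finite-volume Wilson states (`isReflectionPositiveFor_diag_ymSpecification`, Kazakov–Zheng's third
RP family, every `β ≥ 0`) FAILS at every `β < 0`, for EVERY compact gauge group and every continuous
representation with scalar commutant and `ρ ≢ 1` — including `U(1)` and `SU(2)`.

Setting of `DiagonalRPFiniteVolume.lean`: configurations `LGConfig d G` of `ℤ^d`, the swap `Θ` of the
hyperplane `x_i = x_j` (`configDiagSwapZd i j`), the closed half `diagHalfEdges i j = {x_i ≥ x_j}`, a
`plaqSwap`-symmetric finite plaquette set `Q` with its positive / mirror / cut parts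
(`sum_plaquetteObs_split`). A CUT plaquette `p₀` (base point on the mirror, plane `{i, j}`) has the
positive half `A(U) = U(x₀,i) U(x₀+e_i,j)` (`halfPlaq`) and the mirror half `A(ΘU) = U(x₀,j) U(x₀+e_j,i)`;
its holonomy is `A(U) A(ΘU)⁻¹` up to orientation. This file provides:

* `cutBase`, `cutBase_eq_of_mem_plaquetteEdges`, `snd_eq_of_isCutPlaq`,
  **`disjoint_plaquetteEdges_of_isCutPlaq`** — distinct cut plaquettes have disjoint links;
* `wilsonWeight_holonomy_of_isCutPlaq` — `w_β(U_{p}) = w_β(A(U) A(ΘU)⁻¹)` for a cut `p`;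
* the WITNESS `cutWitness ρ β Q p₀ = χ_ρ(A_{p₀}(U)) · exp(-β (A_Q(U) + M_Q(U)/2))` (`cutObs`,
  `halfAction`): measurable, bounded, an observable of the closed half (`dependsOn_cutWitness`);
* **`weight_mul_cutWitness`** — the pointwise identity
  `e^{β ∑_{p∈Q} Re tr ρ(U_p)} · conj F(ΘU) · F(U) = conj χ(A_{p₀}(ΘU)) χ(A_{p₀}(U)) · ∏_{p ∈ Q cut} w_β(U_p)`
  (the positive and mirror parts cancel exactly, `M_Q(ΘU) = M_Q(U)`): only the cut plaquettes weigh.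

Everything is `[folklore]` bookkeeping (K. Osterwalder, E. Seiler, Ann. Phys. 110 (1978) 440, §2:
the cut-plaquette decomposition; its sign at `β < 0` is the content of the next file).
-/

noncomputable section

open MeasureTheory Complex
open scoped ComplexOrder ComplexConjugate
open Literature.Probability.LatticeModels (Site glueWith glueWith_apply_mem glueWith_apply_not_mem
  measurable_glueWith)
open Literature.MathematicalPhysics.QuantumLattice
open Literature.MathematicalPhysics.QuantumFieldTheory (haarProbability)
open Literature.RepresentationTheory.CompactGroups

namespace Summit.QuantumFields.GaugeBoot

namespace DiagRP

variable {d N : ℕ} {i j : Fin d} {G : Type*} [Group G] [TopologicalSpace G] [IsTopologicalGroup G]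
  [CompactSpace G] [MeasurableSpace G] [BorelSpace G] [SecondCountableTopology G]
variable (ρ : G →* Matrix (Fin N) (Fin N) ℂ)

/-! ## Cut plaquettes: the plane and the base point are determined by any one link -/

variable (i j) in
/-- The base point of the cut plaquette a link belongs to, read off the link: outside `{i, j}`
the coordinates of the link's base point, at `i` and `j` the common value `⌊(y_i + y_j)/2⌋`.
[folklore] -/
def cutBase (e : ZdEdge d) : Site d :=
  fun n => if n = i ∨ n = j then (e.1 i + e.1 j) / 2 else e.1 n

omit [Group G] [TopologicalSpace G] [IsTopologicalGroup G] [CompactSpace G] [MeasurableSpace G]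
  [BorelSpace G] [SecondCountableTopology G] in
/-- `cutBase` of a link based at a mirror site. [folklore] -/
theorem cutBase_mirror (hij : i ≠ j) {x : Site d} (hx : x i = x j) (n' : Fin d) :
    cutBase i j (x, n') = x := by
  funext n
  by_cases hn : n = i ∨ n = j
  · simp only [cutBase, if_pos hn]
    rcases hn with rfl | rfl <;> omega
  · simp only [cutBase, if_neg hn]

omit [Group G] [TopologicalSpace G] [IsTopologicalGroup G] [CompactSpace G] [MeasurableSpace G]
  [BorelSpace G] [SecondCountableTopology G] in
/-- `cutBase` of a link based one step off a mirror site in the direction `i` or `j`. [folklore] -/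
theorem cutBase_mirror_add (hij : i ≠ j) {x : Site d} (hx : x i = x j) {m : Fin d}
    (hm : m = i ∨ m = j) (n' : Fin d) : cutBase i j (x + Pi.single m 1, n') = x := by
  funext n
  by_cases hn : n = i ∨ n = j
  · simp only [cutBase, if_pos hn, Pi.add_apply]
    rcases hm with rfl | rfl
    · rw [Pi.single_eq_same, Pi.single_eq_of_ne hij.symm, add_zero]
      rcases hn with rfl | rfl <;> omega
    · rw [Pi.single_eq_same, Pi.single_eq_of_ne hij, add_zero]
      rcases hn with rfl | rfl <;> omega
  · simp only [cutBase, if_neg hn, Pi.add_apply]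
    have hnm : n ≠ m := fun h => hn (h ▸ hm)
    rw [Pi.single_eq_of_ne hnm, add_zero]

omit [Group G] [TopologicalSpace G] [IsTopologicalGroup G] [CompactSpace G] [MeasurableSpace G]
  [BorelSpace G] [SecondCountableTopology G] in
/-- The directions of a cut plaquette are `i` and `j`. [folklore] -/
theorem dirs_of_isCutPlaq (hij : i ≠ j) {p : ZdPlaquette d} (hp : IsCutPlaq i j p) :
    (p.2.1.1 = i ∨ p.2.1.1 = j) ∧ (p.2.1.2 = i ∨ p.2.1.2 = j) := by
  obtain ⟨-, hI, hJ⟩ := hp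
  simp only [HasDir] at hI hJ
  constructor
  · rcases hI with h | h
    · exact Or.inl h
    · rcases hJ with h' | h'
      · exact Or.inr h'
      · exact absurd (h.symm.trans h') hij
  · rcases hJ with h | h
    · rcases hI with h' | h'
      · exact absurd (h'.symm.trans h) hij
      · exact Or.inl h'
    · exact Or.inr h

omit [Group G] [TopologicalSpace G] [IsTopologicalGroup G] [CompactSpace G] [MeasurableSpace G]
  [BorelSpace G] [SecondCountableTopology G] in
/-- **Every link of a cut plaquette remembers the base point.** [folklore] -/
theorem cutBase_eq_of_mem_plaquetteEdges (hij : i ≠ j) {p : ZdPlaquette d} (hp : IsCutPlaq i j p)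
    {e : ZdEdge d} (he : e ∈ plaquetteEdges p) : cutBase i j e = p.1 := by
  obtain ⟨hk, hl⟩ := dirs_of_isCutPlaq hij hp
  have hx : p.1 i = p.1 j := hp.1
  rw [mem_plaquetteEdges_iff] at he
  rcases he with rfl | rfl | rfl | rfl
  · exact cutBase_mirror hij hx _
  · exact cutBase_mirror_add hij hx hk _
  · exact cutBase_mirror_add hij hx hl _
  · exact cutBase_mirror hij hx _

omit [Group G] [TopologicalSpace G] [IsTopologicalGroup G] [CompactSpace G] [MeasurableSpace G]
  [BorelSpace G] [SecondCountableTopology G] in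
/-- Two cut plaquettes lie in the same (ordered) plane `{i, j}`. [folklore] -/
theorem snd_eq_of_isCutPlaq (hij : i ≠ j) {p q : ZdPlaquette d} (hp : IsCutPlaq i j p)
    (hq : IsCutPlaq i j q) : p.2 = q.2 := by
  obtain ⟨hk, hl⟩ := dirs_of_isCutPlaq hij hp
  obtain ⟨hk', hl'⟩ := dirs_of_isCutPlaq hij hq
  have h1 : p.2.1.1 < p.2.1.2 := p.2.2
  have h2 : q.2.1.1 < q.2.1.2 := q.2.2
  have e1 : p.2.1.1 = q.2.1.1 := by omega
  have e2 : p.2.1.2 = q.2.1.2 := by omega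
  exact Subtype.ext (Prod.ext e1 e2)

omit [Group G] [TopologicalSpace G] [IsTopologicalGroup G] [CompactSpace G] [MeasurableSpace G]
  [BorelSpace G] [SecondCountableTopology G] in
/-- **Distinct cut plaquettes have disjoint links.** [folklore] -/
theorem disjoint_plaquetteEdges_of_isCutPlaq (hij : i ≠ j) {p q : ZdPlaquette d}
    (hp : IsCutPlaq i j p) (hq : IsCutPlaq i j q) (hpq : p ≠ q) :
    Disjoint (plaquetteEdges p) (plaquetteEdges q) := by
  refine Finset.disjoint_left.2 fun e hep heq => hpq ?_
  have h1 : p.1 = q.1 := by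
    rw [← cutBase_eq_of_mem_plaquetteEdges hij hp hep, cutBase_eq_of_mem_plaquetteEdges hij hq heq]
  exact Prod.ext h1 (snd_eq_of_isCutPlaq hij hp hq)

/-! ## The Wilson weight of a cut plaquette -/

omit [MeasurableSpace G] [BorelSpace G] [SecondCountableTopology G] in
/-- **The weight of a cut plaquette is `w_β(A(U) A(ΘU)⁻¹)`** (`A = halfPlaq`; the two orientations
of the plane give `A A'⁻¹` or its inverse, and `w_β` is inversion invariant). [folklore] -/
theorem wilsonWeight_holonomy_of_isCutPlaq (hρ : Continuous ρ) (hij : i ≠ j) {p : ZdPlaquette d}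
    (hp : IsCutPlaq i j p) (β : ℝ) (U : LGConfig d G) :
    TwistedSlab.wilsonWeight ρ β (plaquetteHolonomyZd U p.1 p.2.1.1 p.2.1.2) =
      TwistedSlab.wilsonWeight ρ β
        (halfPlaq i j p U * (halfPlaq i j p (configDiagSwapZd i j U))⁻¹) := by
  rw [halfPlaq_configDiagSwapZd hp]
  obtain ⟨x, ⟨⟨k, l⟩, hkl⟩⟩ := p
  obtain ⟨-, hI, hJ⟩ := hp
  simp only [HasDir] at hI hJ
  have hkl' : k ≠ l := ne_of_lt hkl
  unfold halfPlaq
  simp only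
  rcases hI with rfl | rfl <;> rcases hJ with h | h
  · exact absurd h hij
  · subst h
    simp only [plaquetteHolonomyZd, mul_inv_rev, mul_assoc]
  · subst h
    rw [← TwistedSlab.wilsonWeight_inv ρ hρ β]
    simp only [plaquetteHolonomyZd, mul_inv_rev, inv_inv, mul_assoc]
  · exact absurd h hij

/-! ## The witness -/

variable (i j) in
/-- The observable part of the witness: the character of the positive half of the cut plaquette,
`χ_ρ(U(x₀,i) U(x₀+e_i,j))`. [folklore] -/
def cutObs (p₀ : ZdPlaquette d) (U : LGConfig d G) : ℂ := (ρ (halfPlaq i j p₀ U)).trace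

variable (i j) in
/-- Half the action of the closed half: `A_Q(U) + M_Q(U)/2` (positive plaquettes plus half the mirror
plaquettes of `Q`). [folklore] -/
def halfAction (Q : Finset (ZdPlaquette d)) (U : LGConfig d G) : ℝ :=
  ∑ p ∈ Q.filter (IsPosPlaq i j), plaquetteObs ρ p.1 p.2.1.1 p.2.1.2 U +
    (∑ p ∈ Q.filter (IsMirrorPlaq i j), plaquetteObs ρ p.1 p.2.1.1 p.2.1.2 U) / 2

variable (i j) in
/-- **The witness** `F(U) = χ_ρ(A_{p₀}(U)) · exp(-β (A_Q(U) + M_Q(U)/2))`. [folklore] -/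
def cutWitness (β : ℝ) (Q : Finset (ZdPlaquette d)) (p₀ : ZdPlaquette d) (U : LGConfig d G) : ℂ :=
  cutObs i j ρ p₀ U * (Real.exp (-(β * halfAction i j ρ Q U)) : ℂ)

omit [CompactSpace G] [MeasurableSpace G] [BorelSpace G] [SecondCountableTopology G] in
/-- The half plaquette is a continuous function of the configuration. [folklore] -/
theorem continuous_halfPlaq (p : ZdPlaquette d) : Continuous (halfPlaq (G := G) i j p) := by
  unfold halfPlaq
  fun_prop

omit [CompactSpace G] [MeasurableSpace G] [BorelSpace G] [SecondCountableTopology G] in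
/-- `cutObs` is continuous. [folklore] -/
theorem continuous_cutObs (hρ : Continuous ρ) (p₀ : ZdPlaquette d) :
    Continuous (cutObs (G := G) i j ρ p₀) :=
  (hρ.comp (continuous_halfPlaq p₀)).matrix_trace

omit [CompactSpace G] [MeasurableSpace G] [BorelSpace G] [SecondCountableTopology G] in
/-- `halfAction` is continuous. [folklore] -/
theorem continuous_halfAction (hρ : Continuous ρ) (Q : Finset (ZdPlaquette d)) :
    Continuous (halfAction (G := G) i j ρ Q) := by
  unfold halfAction
  exact (continuous_finsetSum _ fun p _ => continuous_plaquetteObs ρ hρ _ _ _).add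
    ((continuous_finsetSum _ fun p _ => continuous_plaquetteObs ρ hρ _ _ _).div_const _)

omit [CompactSpace G] [MeasurableSpace G] [BorelSpace G] [SecondCountableTopology G] in
/-- The witness is continuous. [folklore] -/
theorem continuous_cutWitness (hρ : Continuous ρ) (β : ℝ) (Q : Finset (ZdPlaquette d))
    (p₀ : ZdPlaquette d) : Continuous (cutWitness (G := G) i j ρ β Q p₀) := by
  unfold cutWitness
  exact (continuous_cutObs ρ hρ p₀).mul (continuous_ofReal.comp (Real.continuous_exp.comp
    ((continuous_const.mul (continuous_halfAction ρ hρ Q)).neg)))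

omit [CompactSpace G] in
/-- The witness is measurable. [folklore] -/
theorem measurable_cutWitness (hρ : Continuous ρ) (β : ℝ) (Q : Finset (ZdPlaquette d))
    (p₀ : ZdPlaquette d) : Measurable (cutWitness (G := G) i j ρ β Q p₀) :=
  (continuous_cutWitness ρ hρ β Q p₀).measurable

omit [MeasurableSpace G] [BorelSpace G] [SecondCountableTopology G] in
/-- The witness is bounded (compact configuration space). [folklore] -/
theorem exists_norm_cutWitness_le (hρ : Continuous ρ) (β : ℝ) (Q : Finset (ZdPlaquette d))
    (p₀ : ZdPlaquette d) : ∃ C : ℝ, ∀ U : LGConfig d G, ‖cutWitness i j ρ β Q p₀ U‖ ≤ C := by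
  obtain ⟨C, hC⟩ := (isCompact_univ.image
    (continuous_cutWitness ρ hρ β Q p₀)).isBounded.exists_norm_le
  exact ⟨C, fun U => hC _ ⟨U, Set.mem_univ _, rfl⟩⟩

omit [TopologicalSpace G] [IsTopologicalGroup G] [CompactSpace G] [MeasurableSpace G] [BorelSpace G]
  [SecondCountableTopology G] in
/-- **The witness is an observable of the closed half `{x_i ≥ x_j}`.** [folklore] -/
theorem dependsOn_cutWitness (hij : i ≠ j) (β : ℝ) (Q : Finset (ZdPlaquette d))
    {p₀ : ZdPlaquette d} (hp₀ : IsCutPlaq i j p₀) :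
    DependsOn (cutWitness (G := G) i j ρ β Q p₀) (diagHalfEdges i j) := by
  intro U V hUV
  have hE := isPosEdge_of_isCutPlaq hij hp₀
  unfold cutWitness cutObs halfAction
  rw [halfPlaq_congr p₀ (hUV _ hE.1.1) (hUV _ hE.2.1), sum_pos_congr ρ hij Q hUV,
    sum_mirror_congr ρ Q hUV]

/-! ## The pointwise identity -/

omit [MeasurableSpace G] [BorelSpace G] [SecondCountableTopology G] in
/-- **Only the cut plaquettes weigh.** For a `plaqSwap`-symmetric `Q`:
`e^{β ∑_{p∈Q} Re tr ρ(U_p)} · (conj F(ΘU) · F(U)) = conj χ(A_{p₀}(ΘU)) · χ(A_{p₀}(U)) · ∏_{p∈Q cut} w_β(U_p)`,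
`F = cutWitness`. [folklore] -/
theorem weight_mul_cutWitness (hρ : Continuous ρ) {Q : Finset (ZdPlaquette d)}
    (hQ : ∀ p ∈ Q, plaqSwap i j p ∈ Q) (β : ℝ) (p₀ : ZdPlaquette d) (U : LGConfig d G) :
    (Real.exp (β * ∑ p ∈ Q, plaquetteObs ρ p.1 p.2.1.1 p.2.1.2 U) : ℂ) *
        (conj (cutWitness i j ρ β Q p₀ (configDiagSwapZd i j U)) * cutWitness i j ρ β Q p₀ U) =
      conj (cutObs i j ρ p₀ (configDiagSwapZd i j U)) * cutObs i j ρ p₀ U *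
        ∏ p ∈ Q.filter (IsCutPlaq i j), (TwistedSlab.wilsonWeight ρ β
          (plaquetteHolonomyZd U p.1 p.2.1.1 p.2.1.2) : ℂ) := by
  rw [sum_plaquetteObs_split ρ hρ hQ U]
  have hM := sum_mirror_configDiagSwapZd (i := i) (j := j) ρ hρ Q U
  have hprod : ∏ p ∈ Q.filter (IsCutPlaq i j), (TwistedSlab.wilsonWeight ρ β
      (plaquetteHolonomyZd U p.1 p.2.1.1 p.2.1.2) : ℂ) =
      (Real.exp (β * ∑ p ∈ Q.filter (IsCutPlaq i j), plaquetteObs ρ p.1 p.2.1.1 p.2.1.2 U) : ℂ) := by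
    rw [Finset.mul_sum, Real.exp_sum, Complex.ofReal_prod]
    rfl
  rw [hprod]
  simp only [cutWitness, halfAction, map_mul, Complex.conj_ofReal, hM]
  set A1 := ∑ p ∈ Q.filter (IsPosPlaq i j), plaquetteObs ρ p.1 p.2.1.1 p.2.1.2 U
  set A2 := ∑ p ∈ Q.filter (IsPosPlaq i j), plaquetteObs ρ p.1 p.2.1.1 p.2.1.2 (configDiagSwapZd i j U)
  set M1 := ∑ p ∈ Q.filter (IsMirrorPlaq i j), plaquetteObs ρ p.1 p.2.1.1 p.2.1.2 U
  set C1 := ∑ p ∈ Q.filter (IsCutPlaq i j), plaquetteObs ρ p.1 p.2.1.1 p.2.1.2 U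
  have hexp : (Real.exp (β * (A1 + A2 + M1 + C1)) : ℂ) * (Real.exp (-(β * (A2 + M1 / 2))) : ℂ) *
      (Real.exp (-(β * (A1 + M1 / 2))) : ℂ) = (Real.exp (β * C1) : ℂ) := by
    rw [← Complex.ofReal_mul, ← Complex.ofReal_mul, ← Real.exp_add, ← Real.exp_add]
    congr 2
    ring
  linear_combination (conj (cutObs i j ρ p₀ (configDiagSwapZd i j U)) * cutObs i j ρ p₀ U) * hexp

end DiagRP

end Summit.QuantumFields.GaugeBoot

end
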